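import Summits.QuantumFields.GaugeBoot.Certificates.SparseReducedAppend
import Summits.QuantumFields.GaugeBoot.Certificates.KZL2rpD4Tab
import Summits.QuantumFields.GaugeBoot.Certificates.KZL2rpD4TabS
import Summits.QuantumFields.GaugeBoot.Certificates.KZL2rpD4TabH1
import HarnessLib

/-!
# Reduced problem family `KZL2rpD4LIM` = `KZL2rpD4` + the five class-LIMIT blocks (family appendix; class-LIMIT groundwork, P-A5)

Cell `ym-instrument` (HOME `run/shared/lean/pub/ym-instrument/`), crew (a), seat `ym-instrument-boot-lean-1` (gen 3). The UNCAPPED R0 class-LIMIT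
certificate files of record `certs/a/files/SU2-D4/kzL2rpLIM/*.problem1.json` (11 ENDs at β_std ∈ {9/5, 2}, plain and `sbox`) carry 75 PSD blocks: blocks
`0–69` are byte-for-byte the 70 reduced blocks of the Class-A family `KZL2rpD4` (family signature sha256 `981d7f3d…` = the tree's `KZL2rpD4.EB` of record —
seat check 2026-08-27T05:11Z on all 45 kz-L2-rp-4D files of certs/a) and blocks `70–74` are the class-LIMIT blocks `hankel-site/R1/S0-2` (3×3 on columns
`0,1,2,5,27`), `hankel-site/R2/S0-1` (`0,2,13`), `hankel-link/R1/S0-1` (`1,2,5`), `hd/R1/D0{0..1}` (`y₀−y₁, y₁−y₂, y₂−y₅`), `hd/R1/D1{0..1}` (`y₁−y₂, y₂−y₅,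
y₅−y₂₇`) — identical in all 11 files (appendix signature `bbda4372eff6994c`). This module is the FAMILY TABLE of that 75-block family WITHOUT re-emitting
the 70 blocks: `EB := KZL2rpD4.EB ++ EBlim`, `dimL := KZL2rpD4.dimL ++ [3,2,2,2,2]`, with the three family-level checks of the window route (`dim_chk`,
`row_len`, `sorted_chk`) DERIVED from the landed checks of `KZL2rpD4TabA`/`TabS` plus five tiny decides (`Sparse.dimCheck_append` etc.,
`SparseReducedAppend`), and the interface `dim`/`redBlock`/`redBlock_eq` + `redBlock_left` (blocks `< 70` ARE `KZL2rpD4.redBlock`) / `redE_lim` (blocks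
`70 + t` are `redE EBlim t`). Data only; generator: the seat script `work/pa5` from the problem file (wincore's table layout: block ↦ rows `i` ↦ upper entries
`j − i` ↦ sorted `(v, c)`).

HONEST FRAMING (cells `pub-gaugeboot` / `ym-instrument`): certified bounds on lattice expectations at stated coupling, gauge group, dimension and torus size;
class LIMIT = limit points of even-side torus states, NOT a finite-torus bound; NOT a mass gap, NOT a continuum limit, NOT a string tension; nothing
summit-bearing. This module certifies nothing by itself.
-/

namespace Summit.QuantumFields.GaugeBoot.Certificates.KZL2rpD4LIM

noncomputable section

open Matrix Summit.QuantumFields.GaugeBoot.Certificates.Sparse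

/-- The five class-LIMIT blocks' entry tables (blocks `70–74` of every uncapped kz-L2-rp-4D class-LIMIT problem file of record). -/
def EBlim : List (List (List (List (ℕ × ℤ)))) :=
  [[[[(0, 1)], [(1, 1)], [(2, 1)]], [[(2, 1)], [(5, 1)]], [[(27, 1)]]],
   [[[(0, 1)], [(2, 1)]], [[(13, 1)]]],
   [[[(1, 1)], [(2, 1)]], [[(5, 1)]]],
   [[[(0, 1), (1, Int.negSucc 0)], [(1, 1), (2, Int.negSucc 0)]], [[(2, 1), (5, Int.negSucc 0)]]],
   [[[(1, 1), (2, Int.negSucc 0)], [(2, 1), (5, Int.negSucc 0)]], [[(5, 1), (27, Int.negSucc 0)]]]]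

/-- Dimensions of the five class-LIMIT blocks. -/
def dimLlim : List ℕ := [3, 2, 2, 2, 2]

/-- **Entry tables of the 75-block family**: the 70 blocks of record followed by the five class-LIMIT blocks. -/
def EB : List (List (List (List (ℕ × ℤ)))) := KZL2rpD4.EB ++ EBlim

/-- Block dimensions of the 75-block family. -/
def dimL : List ℕ := KZL2rpD4.dimL ++ dimLlim

set_option maxHeartbeats 0 in
/-- The table of record has 70 blocks (kernel: spine of `KZL2rpD4.EB`). -/
theorem EB70_length : KZL2rpD4.EB.length = 70 := by
  decide +kernel

/-- `KZL2rpD4.dimL` has 70 entries. -/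
theorem dimL70_length : KZL2rpD4.dimL.length = 70 := by
  decide +kernel

/-- Dimension check of the appendix (padded size 48). -/
theorem dim_chk_lim : dimCheck EBlim dimLlim 48 5 = true := by
  decide +kernel

/-- Row-length check of the appendix. -/
theorem row_len_lim : rowLenCheck EBlim 48 5 = true := by
  decide +kernel

/-- Sortedness check of the appendix. -/
theorem sorted_chk_lim : sortedCheck EBlim = true := by
  decide +kernel

/-- **Dimension check of the 75-block family** (derived: 70 blocks of record + appendix). -/
theorem dim_chk : dimCheck EB dimL 48 75 = true := by
  have h := dimCheck_append (EB := KZL2rpD4.EB) (EB₂ := EBlim) (dimL := KZL2rpD4.dimL) (dimL₂ := dimLlim) (m := 48) (nb := 70)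
    (nb₂ := 5) EB70_length dimL70_length KZL2rpD4.dim_chk dim_chk_lim
  exact h

/-- **Row-length check of the 75-block family** (derived). -/
theorem row_len : rowLenCheck EB 48 75 = true := by
  have h := rowLenCheck_append (EB := KZL2rpD4.EB) (EB₂ := EBlim) (m := 48) (nb := 70) (nb₂ := 5) EB70_length
    KZL2rpD4.row_len row_len_lim
  exact h

/-- **Sortedness check of the 75-block family** (derived). -/
theorem sorted_chk : sortedCheck EB = true := by
  have h := sortedCheck_append (EB := KZL2rpD4.EB) (EB₂ := EBlim) KZL2rpD4.sorted_chk sorted_chk_lim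
  exact h

/-! ## Offset table 1 (window route with offset `3430`, as the family of record) -/

/-- Offset-`3430` table of the appendix: all appendix columns are `< 3430`, so every combination is filtered to `[]` (shape kept). -/
def EBH1lim : List (List (List (List (ℕ × ℤ)))) :=
  [[[[], [], []], [[], []], [[]]], [[[], []], [[]]], [[[], []], [[]]], [[[], []], [[]]], [[[], []], [[]]]]

/-- `EBH1lim` is the offset table of the appendix (kernel computation on the small literal). -/
theorem ebh1lim_eq : EBH1lim = EBshift 3430 10878 EBlim := by
  decide +kernel

/-- **Offset table 1 of the 75-block family**: the table of record followed by the (empty-shaped) appendix part. -/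
def EBH1 : List (List (List (List (ℕ × ℤ)))) := KZL2rpD4.EBH1 ++ EBH1lim

/-- `EBH1` is the offset-`3430` table of `EB` (from `KZL2rpD4.ebh1_eq` of record + the appendix computation). -/
theorem ebh1_eq : EBH1 = EBshift 3430 10878 EB := by
  rw [EBH1, EB, EBshift_append, KZL2rpD4.ebh1_eq, ebh1lim_eq]

/-- The offset table inherits sortedness. -/
theorem sortedH1 : sortedCheck EBH1 = true := by
  rw [ebh1_eq]; exact sortedCheck_EBshift 3430 10878 sorted_chk

/-! ## Interface -/

/-- Dimension of block `k`. -/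
def dim (k : Fin 75) : ℕ := dimL.getD k.val 0

/-- **Block `k` as a real matrix-valued linear form** in its own dimension. -/
def redBlock (k : Fin 75) (y : Fin 10878 → ℝ) : Matrix (Fin (dim k)) (Fin (dim k)) ℝ :=
  Sparse.redE EB k.val (dim k) 10878 y

/-- `redBlock` unfolds to `Sparse.redE` (the form used by certificate modules). -/
theorem redBlock_eq (k : Fin 75) (y : Fin 10878 → ℝ) :
    redBlock k y = Sparse.redE EB k.val (dimL.getD k.val 0) 10878 y := rfl

/-- Blocks `< 70` have the dimensions of record. -/
theorem dimL_getD_left {k : ℕ} (hk : k < 70) : dimL.getD k 0 = KZL2rpD4.dimL.getD k 0 := by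
  rw [dimL, List.getD_eq_getElem?_getD, List.getD_eq_getElem?_getD, List.getElem?_append_left (dimL70_length ▸ hk)]

/-- Blocks `70 + t` have the appendix dimensions. -/
theorem dimL_getD_right (t : ℕ) : dimL.getD (70 + t) 0 = dimLlim.getD t 0 := by
  rw [dimL, List.getD_eq_getElem?_getD, List.getD_eq_getElem?_getD, ← dimL70_length,
    List.getElem?_append_right (Nat.le_add_right _ _), Nat.add_sub_cancel_left]

/-- **Blocks `< 70` ARE the reduced blocks of record** (`Sparse.redE` form, any stated dimension `d`). -/
theorem redE_left {k : ℕ} (hk : k < 70) (d : ℕ) (y : Fin 10878 → ℝ) :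
    Sparse.redE EB k d 10878 y = Sparse.redE KZL2rpD4.EB k d 10878 y :=
  redE_append_left KZL2rpD4.EB EBlim (EB70_length ▸ hk) d 10878 y

/-- **Blocks `70 + t` are the appendix blocks** (`Sparse.redE` form). -/
theorem redE_right (t d : ℕ) (y : Fin 10878 → ℝ) :
    Sparse.redE EB (70 + t) d 10878 y = Sparse.redE EBlim t d 10878 y := by
  rw [EB, ← EB70_length]; exact redE_append_right KZL2rpD4.EB EBlim t d 10878 y

/-- **PSD of all 75 blocks from PSD of the 70 blocks of record and of the five appendix blocks** (in the `redE … (dimL.getD k 0)` form the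
certificate modules consume). -/
theorem posSemidef_all {y : Fin 10878 → ℝ}
    (h70 : ∀ k : Fin 70, (Sparse.redE KZL2rpD4.EB k.val (KZL2rpD4.dimL.getD k.val 0) 10878 y).PosSemidef)
    (h5 : ∀ t : Fin 5, (Sparse.redE EBlim t.val (dimLlim.getD t.val 0) 10878 y).PosSemidef) :
    ∀ k : Fin 75, (Sparse.redE EB k.val (dimL.getD k.val 0) 10878 y).PosSemidef := by
  intro k
  by_cases hk : k.val < 70
  · rw [dimL_getD_left hk, redE_left hk]
    exact h70 ⟨k.val, hk⟩
  · obtain ⟨t, ht⟩ : ∃ t, k.val = 70 + t := ⟨k.val - 70, by omega⟩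
    have ht5 : t < 5 := by have := k.isLt; omega
    rw [ht, dimL_getD_right t, redE_right t]
    exact h5 ⟨t, ht5⟩

end

end Summit.QuantumFields.GaugeBoot.Certificates.KZL2rpD4LIM
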